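import Mathlib
import Literature.NumberTheory.Sieve.LinearCongruencePairs
import Literature.NumberTheory.LFunctions.DeterminantEquationDFIProofs
import HarnessLib

/-!
# Exponential sums over pairs of moduli of a pair of linear congruences: one piece is a bilinear
# form with Kloosterman fractions (Duke–Friedlander–Iwaniec)

Topic `Literature/NumberTheory/Sieve` (companion of `LinearCongruencePairs.lean`; the input of the
Duke–Friedlander–Iwaniec bound in divisor-window problems for a pair of linear forms).  Let
`q₀, q̃, r ≥ 1`, `q₁ = r q̃` with `gcd(q̃, r q₀) = 1` and `r ∣ q₀^s`, `a₀, a₁` integers with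
`gcd(q₀,a₀) = gcd(q₁,a₁) = 1`, `Δ = q₁ a₀ − q₀ a₁`, and `e ∣ Δ`, `gcd(e, q₁) = 1`.  For moduli
`d₀ ∈ I` (`e ∣ d₀`, `d₀ ≡ c₀ (mod r)`) and `d₁ = e d₁'`, `d₁' ∈ J` (`d₁' ≡ c₁ (mod r)`,
`gcd(d₁', r) = 1`), a solution `ν(d₀, d₁)` of `d₀ ∣ q₀ν + a₀`, `d₁ ∣ q₁ν + a₁`, an integer `k` and a
real `y`, the PIECE

  `Σ_{d₀ ∈ I} Σ_{d₁' ∈ J} [gcd(q̃ d₀, r q₀ d₁') = 1] a(d₀) b(d₁') e(k (y − ν)/lcm(d₀, e d₁'))`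

is `e(−k a₁ w/r)` times a bilinear form `Σ_{(m,n)=1} α_m β_n e(k' m̄/n + X/(mn))` with
`m = q̃ d₀ ∈ (q̃P, 2q̃P]`, `n = r q₀ d₁' ∈ (rq₀Q, 2rq₀Q]`, `k' = −kΔ`, `X = k q₁ (q₀ y + a₀)`,
`w q̃ c₀ c₁ ≡ 1 (mod r)` (`piece_eq`; the phase identity is `phase_eq`, from
`LinearCongruencePair.exists_sol_eq_kloostermanFraction`), and therefore (`norm_piece_le`) it is
bounded by the Duke–Friedlander–Iwaniec bilinear Kloosterman-fraction bound
(`Literature.NumberTheory.LFunctions.DukeFriedlanderIwaniec1997_bilinearKloostermanFractions`, a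
theorem of the tree):

  `‖piece‖ ≤ K_ε ‖a‖₂ ‖b‖₂ (1 + |X|/(MN)) (|k'| + MN)^{3/8} (M + N)^{11/48+ε}`, `M = q̃P`, `N = rq₀Q`.

Also: the dictionary between "`gcd(d₀,d₁) = e` and the pair is solvable" and the coprimality
`gcd(q̃ d₀, r q₀ d₁') = 1` (`coprime_of_sol`, `sol_of_coprime`), and the reindexing of a sum over
multiples (`sum_Icc_ite_dvd_eq`).  Everything here is PROVED.

## References

* W. Duke, J. Friedlander, H. Iwaniec, *Bilinear forms with Kloosterman fractions*, Invent. Math.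
  128 (1997), 23–43, Theorem 2; *Representations by the determinant and mean values of
  L-functions*, LMS Lecture Note Ser. 237 (1997), 109–115, Proposition p. 110. [folklore]
-/

open Finset Real

namespace Literature.NumberTheory.Sieve.LinearPairKloosterman

open Literature.NumberTheory.Sieve.LinearCongruencePair

/-! ### Reindexing a sum over multiples -/

/-- Reindexing a sum over the multiples `m = q d`, `d ∈ I`, inside `[1, R]`. [folklore] -/
theorem sum_Icc_ite_dvd_eq {E : Type*} [AddCommMonoid E] {q : ℕ} (hq : 0 < q) (I : Finset ℕ)
    {R : ℕ} (hI : ∀ d ∈ I, 1 ≤ q * d ∧ q * d ≤ R) (g : ℕ → E) :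
    ∑ m ∈ Icc 1 R, (if q ∣ m ∧ m / q ∈ I then g m else 0) = ∑ d ∈ I, g (q * d) := by
  classical
  rw [← Finset.sum_filter]
  have himage : (Icc 1 R).filter (fun m => q ∣ m ∧ m / q ∈ I) = I.image (fun d => q * d) := by
    ext m
    simp only [Finset.mem_filter, Finset.mem_Icc, Finset.mem_image]
    constructor
    · rintro ⟨-, ⟨c, rfl⟩, hc⟩
      rw [Nat.mul_div_cancel_left _ hq] at hc
      exact ⟨c, hc, rfl⟩
    · rintro ⟨d, hd, rfl⟩
      rw [Nat.mul_div_cancel_left _ hq]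
      exact ⟨hI d hd, dvd_mul_right _ _, hd⟩
  rw [himage, Finset.sum_image]
  intro a _ b _ h
  exact Nat.eq_of_mul_eq_mul_left hq h

/-! ### Solvability with `gcd(d₀, d₁) = e` versus `gcd(q̃ d₀, r q₀ d₁') = 1` -/

/-- From `gcd(d₀, e d₁') = e`, solvability of the pair and `e d₁'` squarefree to the coprimality
`gcd(q̃ d₀, r q₀ d₁') = 1` (and the side conditions `e ∣ d₀`, `gcd(e, q₁) = 1`, `gcd(d₁', r) = 1`).
Here `q₁ = r q̃`, `gcd(q̃, r q₀) = 1`, `r ∣ q₀^s`. [folklore] -/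
theorem coprime_of_sol {q₀ qt r s e d₀ d₁' : ℕ} {Δ : ℤ} (hsq : Squarefree (e * d₁'))
    (hqt : Nat.Coprime qt (r * q₀)) (hrs : r ∣ q₀ ^ s)
    (hg : Nat.gcd d₀ (e * d₁') = e) (hs₀ : Nat.Coprime d₀ q₀) (hs₁ : Nat.Coprime (e * d₁') (r * qt))
    (_hsΔ : ((Nat.gcd d₀ (e * d₁') : ℕ) : ℤ) ∣ Δ) :
    e ∣ d₀ ∧ Nat.Coprime e (r * qt) ∧ Nat.Coprime d₁' r ∧
      Nat.Coprime (qt * d₀) (r * q₀ * d₁') := by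
  have hed₀ : e ∣ d₀ := hg ▸ Nat.gcd_dvd_left _ _
  have he1 : Nat.Coprime e (r * qt) := Nat.Coprime.coprime_dvd_left (dvd_mul_right e d₁') hs₁
  have hd1 : Nat.Coprime d₁' (r * qt) := Nat.Coprime.coprime_dvd_left (dvd_mul_left d₁' e) hs₁
  have hd1r : Nat.Coprime d₁' r := Nat.Coprime.coprime_dvd_right (dvd_mul_right r qt) hd1
  have hd1q : Nat.Coprime d₁' qt := Nat.Coprime.coprime_dvd_right (dvd_mul_left qt r) hd1
  have hd0r : Nat.Coprime d₀ r :=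
    Nat.Coprime.coprime_dvd_right hrs (Nat.Coprime.pow_right s hs₀)
  -- `gcd(d₀, d₁') = 1`
  have hd0d1 : Nat.Coprime d₀ d₁' := by
    obtain ⟨d', rfl⟩ := hed₀
    have he0 : 0 < e := Nat.pos_of_ne_zero fun h0 => by
      rw [h0, zero_mul] at hsq; exact not_squarefree_zero hsq
    rw [Nat.gcd_mul_left] at hg
    have hg' : Nat.gcd d' d₁' = 1 := by
      have : e * Nat.gcd d' d₁' = e * 1 := by rw [mul_one]; exact hg
      exact Nat.eq_of_mul_eq_mul_left he0 this
    have hed1 : Nat.Coprime e d₁' := (Nat.squarefree_mul_iff.1 hsq).1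
    exact Nat.Coprime.mul_left hed1 hg'
  refine ⟨hed₀, he1, hd1r, ?_⟩
  refine Nat.Coprime.mul_left ?_ ?_
  · exact Nat.Coprime.mul_right hqt hd1q.symm
  · exact Nat.Coprime.mul_right (Nat.Coprime.mul_right hd0r hs₀) hd0d1

/-- Conversely, `e ∣ d₀`, `gcd(e, q₁) = 1`, `gcd(d₁', r) = 1`, `e ∣ Δ` and `gcd(q̃ d₀, r q₀ d₁') = 1`
give `gcd(d₀, e d₁') = e` and the solvability conditions of the pair `(d₀, e d₁')`. [folklore] -/
theorem sol_of_coprime {q₀ qt r e d₀ d₁' : ℕ} {Δ : ℤ} (hed₀ : e ∣ d₀)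
    (he1 : Nat.Coprime e (r * qt)) (hd1r : Nat.Coprime d₁' r) (heΔ : (e : ℤ) ∣ Δ)
    (hMN : Nat.Coprime (qt * d₀) (r * q₀ * d₁')) :
    Nat.gcd d₀ (e * d₁') = e ∧ Nat.Coprime d₀ q₀ ∧ Nat.Coprime (e * d₁') (r * qt) ∧
      ((Nat.gcd d₀ (e * d₁') : ℕ) : ℤ) ∣ Δ := by
  have hd0N : Nat.Coprime d₀ (r * q₀ * d₁') := Nat.Coprime.coprime_dvd_left (dvd_mul_left d₀ qt) hMN
  have hs₀ : Nat.Coprime d₀ q₀ :=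
    Nat.Coprime.coprime_dvd_right ⟨r * d₁', by ring⟩ hd0N
  have hd0d1 : Nat.Coprime d₀ d₁' := Nat.Coprime.coprime_dvd_right (dvd_mul_left d₁' _) hd0N
  have hqtN : Nat.Coprime qt (r * q₀ * d₁') := Nat.Coprime.coprime_dvd_left (dvd_mul_right qt d₀) hMN
  have hd1q : Nat.Coprime d₁' qt := (Nat.Coprime.coprime_dvd_right (dvd_mul_left d₁' _) hqtN).symm
  have hg : Nat.gcd d₀ (e * d₁') = e := by
    obtain ⟨d', rfl⟩ := hed₀
    rw [Nat.gcd_mul_left, (Nat.Coprime.coprime_mul_left hd0d1 : Nat.Coprime d' d₁'), mul_one]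
  refine ⟨hg, hs₀, ?_, by rw [hg]; exact heΔ⟩
  exact Nat.Coprime.mul_left he1 (Nat.Coprime.mul_right hd1r hd1q)

/-! ### The phase is a Kloosterman fraction -/

/-- **The phase identity.**  With `q₁ = r q̃`, `M = q̃ d₀`, `N = r q₀ d₁'` coprime, `e ∣ d₀`, `e ∣ Δ`,
`w q̃ d₀ d₁' ≡ 1 (mod r)` and ANY solution `ν` of `d₀ ∣ q₀ν + a₀`, `e d₁' ∣ q₁ ν + a₁`
(`gcd(qᵢ, aᵢ) = 1`): for every integer `k` and real `y`,
`e(k (y − ν)/lcm(d₀, e d₁')) = e(−k a₁ w/r) · e((−kΔ) ū/N + k q₁ (q₀ y + a₀)/(MN))`,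
`ū = ((M : ZMod N)⁻¹).val` — the Duke–Friedlander–Iwaniec shape `e(k' m̄/n + X/(mn))`
(all solutions are congruent modulo `lcm = d₀ d₁'`, and `exists_sol_eq_kloostermanFraction`).
[folklore] -/
theorem phase_eq {q₀ qt r e d₀ d₁' : ℕ} {a₀ a₁ : ℤ}
    (hq₀ : 0 < q₀) (hqt : 0 < qt) (hr : 0 < r) (hd₀ : 0 < d₀) (hd₁' : 0 < d₁')
    (hc₀ : IsCoprime (q₀ : ℤ) a₀) (hc₁ : IsCoprime ((r * qt : ℕ) : ℤ) a₁)
    (hed₀ : e ∣ d₀) (heΔ : (e : ℤ) ∣ ((r * qt : ℕ) : ℤ) * a₀ - (q₀ : ℤ) * a₁)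
    (hMN : Nat.Coprime (qt * d₀) (r * q₀ * d₁'))
    {w : ℤ} (hw : w * ((qt * d₀ * d₁' : ℕ) : ℤ) ≡ 1 [ZMOD (r : ℕ)])
    {ν : ℤ} (hν₀ : (d₀ : ℤ) ∣ (q₀ : ℤ) * ν + a₀)
    (hν₁ : ((e * d₁' : ℕ) : ℤ) ∣ ((r * qt : ℕ) : ℤ) * ν + a₁) (k : ℤ) (y : ℝ) :
    Complex.exp (2 * π * Complex.I *
        (((k : ℝ) * ((y - (ν : ℝ)) / ((Nat.lcm d₀ (e * d₁') : ℕ) : ℝ)) : ℝ) : ℂ)) =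
      Complex.exp (2 * π * Complex.I * ((-((k : ℝ) * a₁ * w) / r : ℝ) : ℂ)) *
        Complex.exp (2 * π * Complex.I *
          (((-(k * (((r * qt : ℕ) : ℤ) * a₀ - (q₀ : ℤ) * a₁)) : ℤ) : ℂ) *
              ((((qt * d₀ : ℕ) : ZMod (r * q₀ * d₁'))⁻¹.val : ℕ) : ℂ) / ((r * q₀ * d₁' : ℕ) : ℂ) +
            (((k : ℝ) * (((r * qt : ℕ) : ℝ) * ((q₀ : ℝ) * y + (a₀ : ℝ))) : ℝ) : ℂ) /
              (((qt * d₀ : ℕ) : ℂ) * ((r * q₀ * d₁' : ℕ) : ℂ)))) := by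
  -- the Kloosterman-fraction solution
  obtain ⟨νs, hνs₀, hνs₁, hνs⟩ := exists_sol_eq_kloostermanFraction q₀ qt r d₀ d₁' e a₀ a₁
    hq₀ hr hd₀ hd₁' hed₀ heΔ hMN w hw
  set u : ℕ := ((qt * d₀ : ℕ) : ZMod (r * q₀ * d₁'))⁻¹.val with hu
  set Δ : ℤ := ((r * qt : ℕ) : ℤ) * a₀ - (q₀ : ℤ) * a₁ with hΔ
  -- coprimality consequences
  have hcop : Nat.Coprime d₀ d₁' :=
    Nat.Coprime.coprime_dvd_left (dvd_mul_left d₀ qt)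
      (Nat.Coprime.coprime_dvd_right (dvd_mul_left d₁' (r * q₀)) hMN)
  -- `lcm(d₀, e d₁') = d₀ d₁'`
  have hlcm : Nat.lcm d₀ (e * d₁') = d₀ * d₁' := by
    obtain ⟨d', rfl⟩ := hed₀
    rw [Nat.lcm_mul_left, (Nat.Coprime.coprime_mul_left hcop).lcm_eq_mul, mul_assoc]
  -- all solutions are congruent modulo `lcm`
  have hmod : ν ≡ νs [ZMOD (Nat.lcm d₀ (e * d₁') : ℕ)] :=
    (pair_dvd_iff_modEq hc₀ hc₁ hνs₀ hνs₁ ν).1 ⟨hν₀, hν₁⟩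
  rw [hlcm] at hmod
  obtain ⟨z, hz⟩ : ((d₀ * d₁' : ℕ) : ℤ) ∣ ν - νs := Int.ModEq.dvd hmod.symm
  -- real bookkeeping
  have hd0R : (0 : ℝ) < d₀ := by exact_mod_cast hd₀
  have hd1R : (0 : ℝ) < d₁' := by exact_mod_cast hd₁'
  have hrR : (0 : ℝ) < r := by exact_mod_cast hr
  have hq0R : (0 : ℝ) < q₀ := by exact_mod_cast hq₀
  have hqtR : (0 : ℝ) < qt := by exact_mod_cast hqt
  have hνR : (ν : ℝ) = νs + (d₀ : ℝ) * d₁' * z := by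
    have : ν = νs + ((d₀ * d₁' : ℕ) : ℤ) * z := by linear_combination hz
    rw [this]; push_cast; ring
  have hνs' : (νs : ℝ) = (d₀ : ℝ) * d₁' *
      ((Δ : ℝ) * (u : ℝ) / ((r * q₀ * d₁' : ℕ) : ℝ) + (a₁ : ℝ) * w / r -
        (a₀ : ℝ) / ((q₀ : ℝ) * d₀ * d₁')) := by
    rw [← hνs]; field_simp
  -- the real identity between the exponents
  have key : (k : ℝ) * ((y - (ν : ℝ)) / ((d₀ * d₁' : ℕ) : ℝ)) =
      -((k : ℝ) * a₁ * w) / r +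
        (((-(k * Δ) : ℤ) : ℝ) * (u : ℝ) / ((r * q₀ * d₁' : ℕ) : ℝ) +
          (k : ℝ) * (((r * qt : ℕ) : ℝ) * ((q₀ : ℝ) * y + (a₀ : ℝ))) /
            (((qt * d₀ : ℕ) : ℝ) * ((r * q₀ * d₁' : ℕ) : ℝ))) + (-(k * z) : ℤ) := by
    rw [hνR, hνs']
    push_cast
    field_simp
    ring
  -- exponentiate
  rw [hlcm, key]
  push_cast
  rw [show ∀ A B C : ℂ, 2 * (π : ℂ) * Complex.I * (A + B + C) =
      2 * π * Complex.I * A + 2 * π * Complex.I * B + C * (2 * π * Complex.I) from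
    fun A B C => by ring]
  rw [Complex.exp_add, Complex.exp_add]
  rw [show (-((k : ℂ) * (z : ℂ))) = (((-(k * z) : ℤ)) : ℂ) by push_cast; ring,
    Complex.exp_int_mul_two_pi_mul_I, mul_one]

/-! ### One piece as a bilinear form with Kloosterman fractions -/

section Piece

variable {q₀ qt r s e : ℕ} {a₀ a₁ : ℤ}

/-- **One piece is `e(−k a₁ w/r)` times a Duke–Friedlander–Iwaniec bilinear form.**  Data:
`q₁ = r q̃`, `gcd(q̃, r q₀) = 1`, `r ∣ q₀^s`, `gcd(qᵢ, aᵢ) = 1`, `e ∣ Δ`, `gcd(e, q₁) = 1`; finite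
sets `I ⊂ (P, 2P]` of moduli `d₀` with `e ∣ d₀`, `d₀ ≡ c₀ (mod r)`, and `J ⊂ (Q, 2Q]` of `d₁'` with
`d₁' ≡ c₁ (mod r)`, `gcd(d₁', r) = 1`; `w q̃ c₀ c₁ ≡ 1 (mod r)` whenever `gcd(q̃ c₀ c₁, r) = 1`; a
solution map `ν`; complex weights `a, b`; an integer `k` and a real `y`.  Then
`Σ_{d₀∈I} Σ_{d₁'∈J} [gcd(q̃d₀, rq₀d₁') = 1] a(d₀) b(d₁') e(k(y − ν(d₀, ed₁'))/lcm(d₀, ed₁'))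
 = e(−k a₁ w/r) Σ_{m ≤ 2q̃P} Σ_{n ≤ 2rq₀Q} [gcd(m,n)=1] α_m β_n e((−kΔ) m̄/n + k q₁(q₀y + a₀)/(mn))`
with `α_{q̃d₀} = a(d₀)` (`d₀ ∈ I`), `β_{rq₀d₁'} = b(d₁')` (`d₁' ∈ J`), zero elsewhere. [folklore] -/
theorem piece_eq (hq₀ : 0 < q₀) (hqt : 0 < qt) (hr : 0 < r) (he : 0 < e)
    (hc₀ : IsCoprime (q₀ : ℤ) a₀) (hc₁ : IsCoprime ((r * qt : ℕ) : ℤ) a₁)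
    (heΔ : (e : ℤ) ∣ ((r * qt : ℕ) : ℤ) * a₀ - (q₀ : ℤ) * a₁) (he1 : Nat.Coprime e (r * qt))
    {P Q : ℝ} (hP : 0 ≤ P) (hQ : 0 ≤ Q) {I J : Finset ℕ}
    (hI : ∀ d ∈ I, P < d ∧ (d : ℝ) ≤ 2 * P) (hJ : ∀ d ∈ J, Q < d ∧ (d : ℝ) ≤ 2 * Q)
    {c₀ c₁ : ℕ} (hIe : ∀ d ∈ I, e ∣ d) (hIc : ∀ d ∈ I, d ≡ c₀ [MOD r])
    (hJc : ∀ d ∈ J, d ≡ c₁ [MOD r]) (hJr : ∀ d ∈ J, Nat.Coprime d r)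
    {w : ℤ} (hw : Nat.Coprime (qt * c₀ * c₁) r → w * ((qt * c₀ * c₁ : ℕ) : ℤ) ≡ 1 [ZMOD (r : ℕ)])
    (ν : ℕ → ℕ → ℕ)
    (hν : ∀ d₀ d₁ : ℕ, 0 < d₀ → 0 < d₁ → Nat.Coprime d₀ q₀ → Nat.Coprime d₁ (r * qt) →
      ((Nat.gcd d₀ d₁ : ℕ) : ℤ) ∣ ((r * qt : ℕ) : ℤ) * a₀ - (q₀ : ℤ) * a₁ →
        (d₀ : ℤ) ∣ (q₀ : ℤ) * (ν d₀ d₁) + a₀ ∧ (d₁ : ℤ) ∣ ((r * qt : ℕ) : ℤ) * (ν d₀ d₁) + a₁)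
    (a b : ℕ → ℂ) (k : ℤ) (y : ℝ) :
    ∑ d₀ ∈ I, ∑ d₁' ∈ J,
        (if Nat.Coprime (qt * d₀) (r * q₀ * d₁') then
          a d₀ * b d₁' * Complex.exp (2 * π * Complex.I *
            (((k : ℝ) * ((y - (ν d₀ (e * d₁') : ℝ)) / ((Nat.lcm d₀ (e * d₁') : ℕ) : ℝ)) : ℝ) : ℂ))
        else 0) =
      Complex.exp (2 * π * Complex.I * ((-((k : ℝ) * a₁ * w) / r : ℝ) : ℂ)) *
        ∑ m ∈ Icc 1 ⌊2 * ((qt : ℝ) * P)⌋₊, ∑ n ∈ Icc 1 ⌊2 * ((r : ℝ) * q₀ * Q)⌋₊,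
          (if Nat.Coprime m n then
            (if qt ∣ m ∧ m / qt ∈ I then a (m / qt) else 0) *
              (if r * q₀ ∣ n ∧ n / (r * q₀) ∈ J then b (n / (r * q₀)) else 0) *
              Complex.exp (2 * Real.pi * Complex.I *
                (((-(k * (((r * qt : ℕ) : ℤ) * a₀ - (q₀ : ℤ) * a₁)) : ℤ) : ℂ) *
                    ((((m : ZMod n)⁻¹).val : ℕ) : ℂ) / (n : ℂ) +
                  (((k : ℝ) * (((r * qt : ℕ) : ℝ) * ((q₀ : ℝ) * y + (a₀ : ℝ))) : ℝ) : ℂ) /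
                    ((m : ℂ) * n)))
          else 0) := by
  classical
  set C : ℂ := Complex.exp (2 * π * Complex.I * ((-((k : ℝ) * a₁ * w) / r : ℝ) : ℂ)) with hC
  set k' : ℤ := -(k * (((r * qt : ℕ) : ℤ) * a₀ - (q₀ : ℤ) * a₁)) with hk'
  set X : ℝ := (k : ℝ) * (((r * qt : ℕ) : ℝ) * ((q₀ : ℝ) * y + (a₀ : ℝ))) with hX
  -- the DFI summand as a function of `(m, n)`
  set F : ℕ → ℕ → ℂ := fun m n => Complex.exp (2 * Real.pi * Complex.I *
      ((k' : ℂ) * ((((m : ZMod n)⁻¹).val : ℕ) : ℂ) / (n : ℂ) + (X : ℂ) / ((m : ℂ) * n))) with hF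
  have hrq₀ : 0 < r * q₀ := Nat.mul_pos hr hq₀
  -- positivity of the moduli
  have hIpos : ∀ d ∈ I, 0 < d := fun d hd => by
    have h := (hI d hd).1
    have : (0 : ℝ) < d := lt_of_le_of_lt hP h
    exact_mod_cast this
  have hJpos : ∀ d ∈ J, 0 < d := fun d hd => by
    have h := (hJ d hd).1
    have : (0 : ℝ) < d := lt_of_le_of_lt hQ h
    exact_mod_cast this
  -- ranges of the multiples
  have hIR : ∀ d ∈ I, 1 ≤ qt * d ∧ qt * d ≤ ⌊2 * ((qt : ℝ) * P)⌋₊ := fun d hd => by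
    refine ⟨Nat.mul_pos hqt (hIpos d hd), Nat.le_floor ?_⟩
    push_cast
    have := (hI d hd).2
    have hqt0 : (0 : ℝ) ≤ qt := by positivity
    nlinarith
  have hJR : ∀ d ∈ J, 1 ≤ r * q₀ * d ∧ r * q₀ * d ≤ ⌊2 * ((r : ℝ) * q₀ * Q)⌋₊ := fun d hd => by
    refine ⟨Nat.mul_pos hrq₀ (hJpos d hd), Nat.le_floor ?_⟩
    push_cast
    have := (hJ d hd).2
    have h0 : (0 : ℝ) ≤ (r : ℝ) * q₀ := by positivity
    nlinarith
  -- Step 1: reindex `m = q̃ d₀`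
  have step1 : ∑ m ∈ Icc 1 ⌊2 * ((qt : ℝ) * P)⌋₊, ∑ n ∈ Icc 1 ⌊2 * ((r : ℝ) * q₀ * Q)⌋₊,
      (if Nat.Coprime m n then
        (if qt ∣ m ∧ m / qt ∈ I then a (m / qt) else 0) *
          (if r * q₀ ∣ n ∧ n / (r * q₀) ∈ J then b (n / (r * q₀)) else 0) * F m n else 0) =
      ∑ d₀ ∈ I, ∑ n ∈ Icc 1 ⌊2 * ((r : ℝ) * q₀ * Q)⌋₊,
        (if Nat.Coprime (qt * d₀) n then
          a d₀ * (if r * q₀ ∣ n ∧ n / (r * q₀) ∈ J then b (n / (r * q₀)) else 0) * F (qt * d₀) n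
        else 0) := by
    calc ∑ m ∈ Icc 1 ⌊2 * ((qt : ℝ) * P)⌋₊, ∑ n ∈ Icc 1 ⌊2 * ((r : ℝ) * q₀ * Q)⌋₊,
          (if Nat.Coprime m n then
            (if qt ∣ m ∧ m / qt ∈ I then a (m / qt) else 0) *
              (if r * q₀ ∣ n ∧ n / (r * q₀) ∈ J then b (n / (r * q₀)) else 0) * F m n else 0)
        = ∑ m ∈ Icc 1 ⌊2 * ((qt : ℝ) * P)⌋₊, (if qt ∣ m ∧ m / qt ∈ I then
            ∑ n ∈ Icc 1 ⌊2 * ((r : ℝ) * q₀ * Q)⌋₊, (if Nat.Coprime m n then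
              a (m / qt) * (if r * q₀ ∣ n ∧ n / (r * q₀) ∈ J then b (n / (r * q₀)) else 0) * F m n
              else 0) else 0) := by
          refine Finset.sum_congr rfl fun m _ => ?_
          by_cases hm : qt ∣ m ∧ m / qt ∈ I
          · simp only [if_pos hm]
          · simp only [if_neg hm, zero_mul, ite_self, Finset.sum_const_zero]
      _ = ∑ d₀ ∈ I, ∑ n ∈ Icc 1 ⌊2 * ((r : ℝ) * q₀ * Q)⌋₊, (if Nat.Coprime (qt * d₀) n then
              a (qt * d₀ / qt) * (if r * q₀ ∣ n ∧ n / (r * q₀) ∈ J then b (n / (r * q₀)) else 0) *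
                F (qt * d₀) n else 0) :=
          sum_Icc_ite_dvd_eq hqt I hIR (fun m => ∑ n ∈ Icc 1 ⌊2 * ((r : ℝ) * q₀ * Q)⌋₊,
            (if Nat.Coprime m n then
              a (m / qt) * (if r * q₀ ∣ n ∧ n / (r * q₀) ∈ J then b (n / (r * q₀)) else 0) * F m n
              else 0))
      _ = _ := by
          refine Finset.sum_congr rfl fun d₀ _ => ?_
          rw [Nat.mul_div_cancel_left _ hqt]
  -- Step 2: reindex `n = r q₀ d₁'`
  have step2 : ∀ d₀ ∈ I, ∑ n ∈ Icc 1 ⌊2 * ((r : ℝ) * q₀ * Q)⌋₊,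
      (if Nat.Coprime (qt * d₀) n then
        a d₀ * (if r * q₀ ∣ n ∧ n / (r * q₀) ∈ J then b (n / (r * q₀)) else 0) * F (qt * d₀) n
      else 0) =
      ∑ d₁' ∈ J, (if Nat.Coprime (qt * d₀) (r * q₀ * d₁') then
        a d₀ * b d₁' * F (qt * d₀) (r * q₀ * d₁') else 0) := by
    intro d₀ _
    calc ∑ n ∈ Icc 1 ⌊2 * ((r : ℝ) * q₀ * Q)⌋₊,
          (if Nat.Coprime (qt * d₀) n then
            a d₀ * (if r * q₀ ∣ n ∧ n / (r * q₀) ∈ J then b (n / (r * q₀)) else 0) * F (qt * d₀) n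
          else 0)
        = ∑ n ∈ Icc 1 ⌊2 * ((r : ℝ) * q₀ * Q)⌋₊, (if r * q₀ ∣ n ∧ n / (r * q₀) ∈ J then
            (if Nat.Coprime (qt * d₀) n then a d₀ * b (n / (r * q₀)) * F (qt * d₀) n else 0)
            else 0) := by
          refine Finset.sum_congr rfl fun n _ => ?_
          by_cases hn : r * q₀ ∣ n ∧ n / (r * q₀) ∈ J
          · simp only [if_pos hn]
          · simp only [if_neg hn, mul_zero, zero_mul, ite_self]
      _ = ∑ d₁' ∈ J, (if Nat.Coprime (qt * d₀) (r * q₀ * d₁') then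
            a d₀ * b (r * q₀ * d₁' / (r * q₀)) * F (qt * d₀) (r * q₀ * d₁') else 0) :=
          sum_Icc_ite_dvd_eq hrq₀ J hJR (fun n =>
            (if Nat.Coprime (qt * d₀) n then a d₀ * b (n / (r * q₀)) * F (qt * d₀) n else 0))
      _ = _ := by
          refine Finset.sum_congr rfl fun d₁' _ => ?_
          rw [Nat.mul_div_cancel_left _ hrq₀]
  rw [step1, Finset.sum_congr rfl step2, Finset.mul_sum]
  refine Finset.sum_congr rfl fun d₀ hd₀ => ?_
  rw [Finset.mul_sum]
  refine Finset.sum_congr rfl fun d₁' hd₁' => ?_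
  by_cases hMN : Nat.Coprime (qt * d₀) (r * q₀ * d₁')
  swap
  · rw [if_neg hMN, if_neg hMN, mul_zero]
  rw [if_pos hMN, if_pos hMN]
  -- the phase identity applies
  have hd₀pos := hIpos d₀ hd₀
  have hd₁pos := hJpos d₁' hd₁'
  have hsol := sol_of_coprime (q₀ := q₀) (hIe d₀ hd₀) he1 (hJr d₁' hd₁') heΔ hMN
  obtain ⟨hν₀, hν₁⟩ := hν d₀ (e * d₁') hd₀pos (Nat.mul_pos he hd₁pos) hsol.2.1 hsol.2.2.1 hsol.2.2.2
  -- `w q̃ d₀ d₁' ≡ 1 (mod r)`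
  have hmodprod : qt * d₀ * d₁' ≡ qt * c₀ * c₁ [MOD r] :=
    Nat.ModEq.mul (Nat.ModEq.mul_left _ (hIc d₀ hd₀)) (hJc d₁' hd₁')
  have hcopc : Nat.Coprime (qt * c₀ * c₁) r := by
    have h1 : Nat.Coprime (qt * d₀) r :=
      Nat.Coprime.coprime_dvd_right ⟨q₀ * d₁', by ring⟩ hMN
    have h2 : Nat.Coprime (qt * d₀ * d₁') r := Nat.Coprime.mul_left h1 (hJr d₁' hd₁')
    rw [Nat.Coprime, ← hmodprod.gcd_eq]
    exact h2
  have hw' : w * ((qt * d₀ * d₁' : ℕ) : ℤ) ≡ 1 [ZMOD (r : ℕ)] := by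
    have h1 : ((qt * d₀ * d₁' : ℕ) : ℤ) ≡ ((qt * c₀ * c₁ : ℕ) : ℤ) [ZMOD (r : ℕ)] :=
      (Int.natCast_modEq_iff.2 hmodprod)
    exact (Int.ModEq.mul_left w h1).trans (hw hcopc)
  have hph := phase_eq hq₀ hqt hr hd₀pos hd₁pos hc₀ hc₁ (hIe d₀ hd₀) heΔ hMN hw'
    (ν := (ν d₀ (e * d₁') : ℤ)) (by exact_mod_cast hν₀) (by exact_mod_cast hν₁) k y
  have hcast : ((ν d₀ (e * d₁') : ℤ) : ℝ) = (ν d₀ (e * d₁') : ℝ) := by norm_cast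
  rw [hcast] at hph
  rw [hph, hC, hF]
  ring

/-- **The Duke–Friedlander–Iwaniec bound for one piece.**  In the situation of `piece_eq`, if
`P, Q ≥ 1/2`, `kΔ ≠ 0` and `K, ε` are such that the bilinear Kloosterman-fraction bound of
Duke–Friedlander–Iwaniec holds with constant `K` and exponent `11/48 + ε` (the named fact
`DukeFriedlanderIwaniec1997_bilinearKloostermanFractions` of the tree, a theorem there), then
`‖piece‖ ≤ K ‖a‖₂ ‖b‖₂ (1 + |X|/(MN)) (|kΔ| + MN)^{3/8} (M + N)^{11/48+ε}` with `M = q̃P`,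
`N = r q₀ Q`, `X = k q₁ (q₀ y + a₀)`. [folklore] -/
theorem norm_piece_le (hq₀ : 0 < q₀) (hqt : 0 < qt) (hr : 0 < r) (he : 0 < e)
    (hc₀ : IsCoprime (q₀ : ℤ) a₀) (hc₁ : IsCoprime ((r * qt : ℕ) : ℤ) a₁)
    (heΔ : (e : ℤ) ∣ ((r * qt : ℕ) : ℤ) * a₀ - (q₀ : ℤ) * a₁) (he1 : Nat.Coprime e (r * qt))
    {P Q : ℝ} (hP : 1 / 2 ≤ P) (hQ : 1 / 2 ≤ Q) {I J : Finset ℕ}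
    (hI : ∀ d ∈ I, P < d ∧ (d : ℝ) ≤ 2 * P) (hJ : ∀ d ∈ J, Q < d ∧ (d : ℝ) ≤ 2 * Q)
    {c₀ c₁ : ℕ} (hIe : ∀ d ∈ I, e ∣ d) (hIc : ∀ d ∈ I, d ≡ c₀ [MOD r])
    (hJc : ∀ d ∈ J, d ≡ c₁ [MOD r]) (hJr : ∀ d ∈ J, Nat.Coprime d r)
    {w : ℤ} (hw : Nat.Coprime (qt * c₀ * c₁) r → w * ((qt * c₀ * c₁ : ℕ) : ℤ) ≡ 1 [ZMOD (r : ℕ)])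
    (ν : ℕ → ℕ → ℕ)
    (hν : ∀ d₀ d₁ : ℕ, 0 < d₀ → 0 < d₁ → Nat.Coprime d₀ q₀ → Nat.Coprime d₁ (r * qt) →
      ((Nat.gcd d₀ d₁ : ℕ) : ℤ) ∣ ((r * qt : ℕ) : ℤ) * a₀ - (q₀ : ℤ) * a₁ →
        (d₀ : ℤ) ∣ (q₀ : ℤ) * (ν d₀ d₁) + a₀ ∧ (d₁ : ℤ) ∣ ((r * qt : ℕ) : ℤ) * (ν d₀ d₁) + a₁)
    (a b : ℕ → ℂ) {k : ℤ} (hk : k * (((r * qt : ℕ) : ℤ) * a₀ - (q₀ : ℤ) * a₁) ≠ 0) (y : ℝ)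
    {K ε : ℝ}
    (hDFI : ∀ (M N : ℝ), 1 / 2 ≤ M → 1 / 2 ≤ N → ∀ (k : ℤ), k ≠ 0 → ∀ (X : ℝ) (α β : ℕ → ℂ),
      (∀ m : ℕ, α m ≠ 0 → M < m ∧ (m : ℝ) ≤ 2 * M) →
      (∀ n : ℕ, β n ≠ 0 → N < n ∧ (n : ℝ) ≤ 2 * N) →
      ‖∑ m ∈ Finset.Icc 1 (Nat.floor (2 * M)), ∑ n ∈ Finset.Icc 1 (Nat.floor (2 * N)),
          if Nat.Coprime m n then
            α m * β n * Complex.exp (2 * Real.pi * Complex.I *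
              ((k : ℂ) * ((((m : ZMod n)⁻¹).val : ℕ) : ℂ) / (n : ℂ) + (X : ℂ) / ((m : ℂ) * n)))
          else 0‖ ≤
        K * Real.sqrt (∑ m ∈ Finset.Icc 1 (Nat.floor (2 * M)), ‖α m‖ ^ 2) *
          Real.sqrt (∑ n ∈ Finset.Icc 1 (Nat.floor (2 * N)), ‖β n‖ ^ 2) *
          (1 + |X| / (M * N)) * (|(k : ℝ)| + M * N) ^ (3 / 8 : ℝ) * (M + N) ^ (11 / 48 + ε)) :
    ‖∑ d₀ ∈ I, ∑ d₁' ∈ J,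
        (if Nat.Coprime (qt * d₀) (r * q₀ * d₁') then
          a d₀ * b d₁' * Complex.exp (2 * π * Complex.I *
            (((k : ℝ) * ((y - (ν d₀ (e * d₁') : ℝ)) / ((Nat.lcm d₀ (e * d₁') : ℕ) : ℝ)) : ℝ) : ℂ))
        else 0)‖ ≤
      K * Real.sqrt (∑ d₀ ∈ I, ‖a d₀‖ ^ 2) * Real.sqrt (∑ d₁' ∈ J, ‖b d₁'‖ ^ 2) *
        (1 + |(k : ℝ) * (((r * qt : ℕ) : ℝ) * ((q₀ : ℝ) * y + (a₀ : ℝ)))| /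
          ((qt : ℝ) * P * ((r : ℝ) * q₀ * Q))) *
        (|((-(k * (((r * qt : ℕ) : ℤ) * a₀ - (q₀ : ℤ) * a₁)) : ℤ) : ℝ)| +
            (qt : ℝ) * P * ((r : ℝ) * q₀ * Q)) ^ (3 / 8 : ℝ) *
        ((qt : ℝ) * P + (r : ℝ) * q₀ * Q) ^ (11 / 48 + ε) := by
  classical
  have hP0 : 0 ≤ P := by linarith
  have hQ0 : 0 ≤ Q := by linarith
  rw [piece_eq hq₀ hqt hr he hc₀ hc₁ heΔ he1 hP0 hQ0 hI hJ hIe hIc hJc hJr hw ν hν a b k y,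
    norm_mul, Literature.NumberTheory.LFunctions.DFI_norm_e, one_mul]
  set M : ℝ := (qt : ℝ) * P with hM
  set N : ℝ := (r : ℝ) * q₀ * Q with hN
  set α : ℕ → ℂ := fun m => if qt ∣ m ∧ m / qt ∈ I then a (m / qt) else 0 with hα
  set β : ℕ → ℂ := fun n => if r * q₀ ∣ n ∧ n / (r * q₀) ∈ J then b (n / (r * q₀)) else 0 with hβ
  have hqtR : (0 : ℝ) < qt := by exact_mod_cast hqt
  have hrq₀ : 0 < r * q₀ := Nat.mul_pos hr hq₀
  have hrqR : (0 : ℝ) < (r : ℝ) * q₀ := by exact_mod_cast hrq₀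
  have hM2 : 1 / 2 ≤ M := by
    rw [hM]
    have h1 : (1 : ℝ) ≤ qt := by exact_mod_cast hqt
    nlinarith
  have hN2 : 1 / 2 ≤ N := by
    rw [hN]
    have h1 : (1 : ℝ) ≤ (r : ℝ) * q₀ := by exact_mod_cast hrq₀
    nlinarith
  -- supports
  have hαs : ∀ m : ℕ, α m ≠ 0 → M < m ∧ (m : ℝ) ≤ 2 * M := by
    intro m hm
    simp only [hα] at hm
    by_cases hc : qt ∣ m ∧ m / qt ∈ I
    · obtain ⟨⟨c, rfl⟩, hcI⟩ := hc
      rw [Nat.mul_div_cancel_left _ hqt] at hcI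
      obtain ⟨h1, h2⟩ := hI c hcI
      push_cast
      rw [hM]
      exact ⟨mul_lt_mul_of_pos_left h1 hqtR, by nlinarith⟩
    · exact absurd (if_neg hc) hm
  have hβs : ∀ n : ℕ, β n ≠ 0 → N < n ∧ (n : ℝ) ≤ 2 * N := by
    intro n hn
    simp only [hβ] at hn
    by_cases hc : r * q₀ ∣ n ∧ n / (r * q₀) ∈ J
    · obtain ⟨⟨c, rfl⟩, hcJ⟩ := hc
      rw [Nat.mul_div_cancel_left _ hrq₀] at hcJ
      obtain ⟨h1, h2⟩ := hJ c hcJ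
      push_cast
      rw [hN]
      exact ⟨mul_lt_mul_of_pos_left h1 hrqR, by nlinarith⟩
    · exact absurd (if_neg hc) hn
  -- the `ℓ²` norms
  have hIR : ∀ d ∈ I, 1 ≤ qt * d ∧ qt * d ≤ ⌊2 * M⌋₊ := fun d hd => by
    have hdpos : 0 < d := by
      have : (0 : ℝ) < d := lt_of_le_of_lt hP0 (hI d hd).1
      exact_mod_cast this
    refine ⟨Nat.mul_pos hqt hdpos, Nat.le_floor ?_⟩
    push_cast
    rw [hM]
    have := (hI d hd).2
    nlinarith
  have hJR : ∀ d ∈ J, 1 ≤ r * q₀ * d ∧ r * q₀ * d ≤ ⌊2 * N⌋₊ := fun d hd => by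
    have hdpos : 0 < d := by
      have : (0 : ℝ) < d := lt_of_le_of_lt hQ0 (hJ d hd).1
      exact_mod_cast this
    refine ⟨Nat.mul_pos hrq₀ hdpos, Nat.le_floor ?_⟩
    push_cast
    rw [hN]
    have := (hJ d hd).2
    nlinarith
  have hαn : ∑ m ∈ Icc 1 ⌊2 * M⌋₊, ‖α m‖ ^ 2 = ∑ d₀ ∈ I, ‖a d₀‖ ^ 2 := by
    have h1 : ∀ m, ‖α m‖ ^ 2 = if qt ∣ m ∧ m / qt ∈ I then ‖a (m / qt)‖ ^ 2 else 0 := by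
      intro m
      simp only [hα]
      split_ifs <;> simp
    simp_rw [h1]
    rw [sum_Icc_ite_dvd_eq hqt I hIR (fun m => ‖a (m / qt)‖ ^ 2)]
    refine Finset.sum_congr rfl fun d _ => ?_
    rw [Nat.mul_div_cancel_left _ hqt]
  have hβn : ∑ n ∈ Icc 1 ⌊2 * N⌋₊, ‖β n‖ ^ 2 = ∑ d₁' ∈ J, ‖b d₁'‖ ^ 2 := by
    have h1 : ∀ n, ‖β n‖ ^ 2 =
        if r * q₀ ∣ n ∧ n / (r * q₀) ∈ J then ‖b (n / (r * q₀))‖ ^ 2 else 0 := by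
      intro n
      simp only [hβ]
      split_ifs <;> simp
    simp_rw [h1]
    rw [sum_Icc_ite_dvd_eq hrq₀ J hJR (fun n => ‖b (n / (r * q₀))‖ ^ 2)]
    refine Finset.sum_congr rfl fun d _ => ?_
    rw [Nat.mul_div_cancel_left _ hrq₀]
  have hk' : (-(k * (((r * qt : ℕ) : ℤ) * a₀ - (q₀ : ℤ) * a₁)) : ℤ) ≠ 0 := neg_ne_zero.2 hk
  have h := hDFI M N hM2 hN2 _ hk' ((k : ℝ) * (((r * qt : ℕ) : ℝ) * ((q₀ : ℝ) * y + (a₀ : ℝ))))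
    α β hαs hβs
  rw [hαn, hβn] at h
  convert h using 4

end Piece

end Literature.NumberTheory.Sieve.LinearPairKloosterman
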